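import Literature.Analysis.FunctionSpaces.LittlewoodPaley
import HarnessLib

/-!
# Chemin–Lerner space-time Besov norms `L̃^ρ(S; Ḃ^s_{p,q})`, GKP's path spaces `𝓛^{a:b}_{p,q}` and Kato norms

Definitions file (no new analysis), in the vocabulary of `LittlewoodPaley.lean` (blocks `Literature.Analysis.FunctionSpaces.lpBlock`,
`L^p` norms of distributions `Literature.Analysis.FunctionSpaces.eLpNormDistrib`), for time-dependent tempered distributions
`U : ℝ → 𝓢'(E, F)` — the form in which `CriticalRegularity.lean` sees Navier–Stokes solutions in Besov
spaces (`U t` = the distribution of the slice `u t`):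

* `Literature.eCheminLernerNorm ρ S s p q U = ‖U‖_{L̃^ρ(S; Ḃ^s_{p,q})} := ‖(2^{js} ‖‖Δ̇_j U(t)‖_{L^p_x}‖_{L^ρ_t(S)})_j‖_{ℓ^q(ℤ)}`
  (Gallagher–Koch–Planchon 2016, Def. 1.2, after Chemin–Lerner 1995; Bahouri–Chemin–Danchin Def. 2.67;
  Danchin 2018, Rem. 2.2): the time integration is performed **before** the `ℓ^q` summation over the
  blocks;
* `Literature.eGKPPathNorm a b p q t₁ t₂ U = ‖U‖_{𝓛^{a:b}_{p,q}(t₁,t₂)}`, the norm of GKP's path space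
  `𝓛^{a:b}_{p,q}(t₁,t₂) := L̃^a([t₁,t₂]; Ḃ^{s_p+2/a}_{p,q}) ∩ L̃^b([t₁,t₂]; Ḃ^{s_p+2/b}_{p,q})`, `s_p = -1 + d/p`
  (GKP 2016, (1.5); their `X_T = 𝓛^{1:∞}_{p,q}(T)` is the existence and uniqueness class of `NS(u₀)`);
* `Literature.eKatoNormDistrib α T p U = ‖U‖ := sup_{0<t≤T} t^α ‖U(t)‖_{L^p}` (GKP 2016, (4.1), the Kato space
  `𝒦_q(T)` with `α = -s_q/2 = (1 - 3/q)/2`; Kato 1984).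

All three are `[0, ∞]`-valued (`∞` off the space), like `Literature.Analysis.FunctionSpaces.eHomBesovNorm`; membership in the spaces is
finiteness of the norm. Only definitional API is given here (unfolding, monotonicity in the time
set, the value at `U = 0`); the estimates for the heat flow (`e^{tΔ}U₀ ∈ 𝓛^{1:∞}_{p,q}(∞)`,
`‖e^{tΔ}U₀‖_{𝒦_p} ≲ ‖U₀‖_{Ḃ^{s_p}_{p,∞}}`) live in the proof files
`LittlewoodPaleyHeatProofs.lean` / `LittlewoodPaleyConvergenceProofs.lean` (blockwise and `L^p` forms).

## Design notes

* The time norm is Mathlib's `eLpNorm` on `volume.restrict S` of the `[0,∞]`-valued function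
  `t ↦ ‖Δ̇_j U(t)‖_{L^p}` (no measurability is needed to *define* it; for `ρ = ∞` it is an essential
  supremum, as in GKP's `L^ρ([t₁,t₂]; L^p_x)`). The `ℓ^q(ℤ)` norm is `eLpNorm` for the counting measure,
  exactly as in `Literature.Analysis.FunctionSpaces.eHomBesovNorm`; `q = ∞` is the supremum over `j`.
* `2/a` for `a : ℝ≥0∞` is rendered `2 * a.toReal⁻¹`, which is `0` for `a = ∞` (`s_p + 2/∞ = s_p`) and the
  honest `2/a` for `0 < a < ∞` (GKP use `a, b ∈ [1, ∞]`).
* `d = Module.finrank ℝ E` (`= 3` in GKP); `s_p = -1 + d/p` with `d/∞ = 0`.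
* The Kato norm is a genuine supremum over `t ∈ (0, T]` (GKP (4.1): `sup_{0<t≤T}`), for
  distribution-valued paths; the function-valued Kato class of `CriticalRegularity.lean`
  (`NS.MemKatoClassOn`, `p = ∞`, weight `√t`) is the case `α = 1/2` read through `NS.IsDistributionOf`.

## References

* I. Gallagher, G. S. Koch, F. Planchon, *Blow-up of critical Besov norms at a potential Navier–Stokes
  singularity*, Comm. Math. Phys. 343 (2016), Def. 1.2, (1.4), (1.5), (4.1). [cite: GKP2016, Def. 1.2]
* J.-Y. Chemin, N. Lerner, *Flot de champs de vecteurs non lipschitziens et équations de Navier–Stokes*,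
  J. Differential Equations 121 (1995) 314–328 (the spaces `L̃^ρ_T(Ḃ^s)`).
* H. Bahouri, J.-Y. Chemin, R. Danchin, *Fourier Analysis and Nonlinear PDE* (2011), Def. 2.67.
  [cite: BahouriCheminDanchin2011, Def. 2.67]
* R. Danchin, *Fourier analysis methods for the compressible Navier–Stokes equations* (2018;
  arXiv:1507.02637), Remark 2.2 (p. 6: the norms `‖·‖_{L̃^a_t(Ḃ^σ_{b,c})}`). [cite: Danchin2018FourierCNS, Rem. 2.2]
* T. Kato, *Strong `L^p`-solutions of the Navier–Stokes equation in `ℝ^m`*, Math. Z. 187 (1984).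
-/

noncomputable section

open MeasureTheory TemperedDistribution Set Filter Topology Function
open scoped SchwartzMap ENNReal NNReal

namespace Literature.Analysis.FunctionSpaces

variable {E F : Type*} [NormedAddCommGroup E] [InnerProductSpace ℝ E] [FiniteDimensional ℝ E]
  [MeasurableSpace E] [BorelSpace E] [NormedAddCommGroup F] [NormedSpace ℂ F] [CompleteSpace F]

/-! ## Chemin–Lerner norms -/

/-- The time-`L^ρ` norm of the `j`-th block of a path `U : ℝ → 𝓢'(E, F)` on the time set `S`:
`‖‖Δ̇_j U(t)‖_{L^p_x}‖_{L^ρ_t(S)} ∈ [0, ∞]` (GKP 2016, Def. 1.2, the inner norm). [cite: GKP2016, Def. 1.2] -/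
def eBlockTimeNorm (ρ : ℝ≥0∞) (S : Set ℝ) (p : ℝ≥0∞) [Fact (1 ≤ p)] (U : ℝ → 𝓢'(E, F)) (j : ℤ) : ℝ≥0∞ :=
  eLpNorm (fun t : ℝ => eLpNormDistrib p (lpBlock j (U t))) ρ (volume.restrict S)

/-- **Chemin–Lerner norm** `‖U‖_{L̃^ρ(S; Ḃ^s_{p,q})} := ‖(2^{js} ‖‖Δ̇_j U(t)‖_{L^p_x}‖_{L^ρ_t(S)})_{j∈ℤ}‖_{ℓ^q}`
(Gallagher–Koch–Planchon 2016, Def. 1.2; Bahouri–Chemin–Danchin Def. 2.67): time integration before the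
summation over the blocks. `[0, ∞]`-valued; `U ∈ L̃^ρ(S; Ḃ^s_{p,q})` iff the value is finite. [cite: GKP2016, Def. 1.2] -/
def eCheminLernerNorm (ρ : ℝ≥0∞) (S : Set ℝ) (s : ℝ) (p q : ℝ≥0∞) [Fact (1 ≤ p)]
    (U : ℝ → 𝓢'(E, F)) : ℝ≥0∞ :=
  eLpNorm (fun j : ℤ => (2 : ℝ≥0∞) ^ ((j : ℝ) * s) * eBlockTimeNorm ρ S p U j) q Measure.count

/-- Unfolding the inner norm. [cite: GKP2016, Def. 1.2] -/
theorem eBlockTimeNorm_def (ρ : ℝ≥0∞) (S : Set ℝ) (p : ℝ≥0∞) [Fact (1 ≤ p)] (U : ℝ → 𝓢'(E, F))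
    (j : ℤ) :
    eBlockTimeNorm ρ S p U j = eLpNorm (fun t : ℝ => eLpNormDistrib p (lpBlock j (U t))) ρ
      (volume.restrict S) :=
  rfl

/-- Unfolding the Chemin–Lerner norm. [cite: GKP2016, Def. 1.2] -/
theorem eCheminLernerNorm_def (ρ : ℝ≥0∞) (S : Set ℝ) (s : ℝ) (p q : ℝ≥0∞) [Fact (1 ≤ p)]
    (U : ℝ → 𝓢'(E, F)) :
    eCheminLernerNorm ρ S s p q U = eLpNorm
      (fun j : ℤ => (2 : ℝ≥0∞) ^ ((j : ℝ) * s) * eBlockTimeNorm ρ S p U j) q Measure.count :=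
  rfl

/-- For `q = ∞` the Chemin–Lerner norm is `sup_j 2^{js} ‖‖Δ̇_j U(t)‖_{L^p}‖_{L^ρ_t(S)}`
(GKP 2016, Def. 1.2). [cite: GKP2016, Def. 1.2] -/
theorem eCheminLernerNorm_top (ρ : ℝ≥0∞) (S : Set ℝ) (s : ℝ) (p : ℝ≥0∞) [Fact (1 ≤ p)]
    (U : ℝ → 𝓢'(E, F)) :
    eCheminLernerNorm ρ S s p ∞ U = ⨆ j : ℤ, (2 : ℝ≥0∞) ^ ((j : ℝ) * s) * eBlockTimeNorm ρ S p U j := by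
  simp [eCheminLernerNorm]

/-- The inner norm is monotone in the time set. [folklore] -/
theorem eBlockTimeNorm_mono {ρ : ℝ≥0∞} {S S' : Set ℝ} (h : S ⊆ S') (p : ℝ≥0∞) [Fact (1 ≤ p)]
    (U : ℝ → 𝓢'(E, F)) (j : ℤ) : eBlockTimeNorm ρ S p U j ≤ eBlockTimeNorm ρ S' p U j :=
  eLpNorm_mono_measure _ (Measure.restrict_mono h le_rfl)

/-- **The Chemin–Lerner norm is monotone in the time set** (GKP 2016, Rem. 1.3: the notation
`𝓛[T < T*]` carries no uniformity as `T ↗ T*`, precisely because these norms grow with the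
interval). [cite: GKP2016, Rem. 1.3] -/
theorem eCheminLernerNorm_mono {ρ : ℝ≥0∞} {S S' : Set ℝ} (h : S ⊆ S') (s : ℝ) (p q : ℝ≥0∞)
    [Fact (1 ≤ p)] (U : ℝ → 𝓢'(E, F)) :
    eCheminLernerNorm ρ S s p q U ≤ eCheminLernerNorm ρ S' s p q U := by
  unfold eCheminLernerNorm
  refine eLpNorm_mono_enorm fun j => ?_
  simp only [enorm_eq_self]
  gcongr
  exact eBlockTimeNorm_mono h p U j

/-- The inner norm of the zero path vanishes. [folklore] -/
@[simp]
theorem eBlockTimeNorm_zero (ρ : ℝ≥0∞) (S : Set ℝ) (p : ℝ≥0∞) [Fact (1 ≤ p)] (j : ℤ) :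
    eBlockTimeNorm ρ S p (0 : ℝ → 𝓢'(E, F)) j = 0 := by
  simp [eBlockTimeNorm]

/-- The Chemin–Lerner norm of the zero path vanishes. [folklore] -/
@[simp]
theorem eCheminLernerNorm_zero (ρ : ℝ≥0∞) (S : Set ℝ) (s : ℝ) (p q : ℝ≥0∞) [Fact (1 ≤ p)] :
    eCheminLernerNorm ρ S s p q (0 : ℝ → 𝓢'(E, F)) = 0 := by
  have h : (fun j : ℤ => (2 : ℝ≥0∞) ^ ((j : ℝ) * s) * eBlockTimeNorm ρ S p (0 : ℝ → 𝓢'(E, F)) j) = 0 := by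
    funext j; simp
  rw [eCheminLernerNorm, h, eLpNorm_zero]

/-- On the empty time set every Chemin–Lerner norm vanishes. [folklore] -/
@[simp]
theorem eCheminLernerNorm_empty (ρ : ℝ≥0∞) (s : ℝ) (p q : ℝ≥0∞) [Fact (1 ≤ p)]
    (U : ℝ → 𝓢'(E, F)) : eCheminLernerNorm ρ ∅ s p q U = 0 := by
  have h : (fun j : ℤ => (2 : ℝ≥0∞) ^ ((j : ℝ) * s) * eBlockTimeNorm ρ ∅ p U j) = 0 := by
    funext j; simp [eBlockTimeNorm]
  rw [eCheminLernerNorm, h, eLpNorm_zero]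

/-! ## GKP's path spaces `𝓛^{a:b}_{p,q}(t₁, t₂)` -/

variable (E) in
/-- The critical regularity index `s_p = -1 + d/p`, `d = dim E` (GKP 2016, §1.2: `s_p := -1 + 3/p`;
`d/∞ = 0`). [cite: GKP2016, §1.2] -/
def criticalIndex (p : ℝ≥0∞) : ℝ := -1 + Module.finrank ℝ E / p.toReal

omit [FiniteDimensional ℝ E] [MeasurableSpace E] [BorelSpace E] in
/-- `s_p = -1 + d/p`. [cite: GKP2016, §1.2] -/
theorem criticalIndex_def (p : ℝ≥0∞) : criticalIndex E p = -1 + Module.finrank ℝ E / p.toReal := rfl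

/-- **GKP's path-space norm** `‖U‖_{𝓛^{a:b}_{p,q}(t₁,t₂)}`: the larger of the two Chemin–Lerner norms
`‖U‖_{L̃^a((t₁,t₂); Ḃ^{s_p+2/a}_{p,q})}` and `‖U‖_{L̃^b((t₁,t₂); Ḃ^{s_p+2/b}_{p,q})}` (Gallagher–Koch–Planchon
2016, (1.5): `𝓛^{a:b}_{p,q}(t₁,t₂) := L̃^a([t₁,t₂]; Ḃ^{s_p+2/a}_{p,q}) ∩ L̃^b([t₁,t₂]; Ḃ^{s_p+2/b}_{p,q})`, normed by
the maximum; `𝓛^{1:∞}_{p,q}(T) = 𝓛^{1:∞}_{p,q}(0,T)` is the class `X_T` in which `NS(u₀)` exists and is unique).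
The open interval `(t₁, t₂)` carries the same `L^ρ` norms as the closed one. [cite: GKP2016, (1.5)] -/
def eGKPPathNorm (a b p q : ℝ≥0∞) [Fact (1 ≤ p)] (t₁ t₂ : ℝ) (U : ℝ → 𝓢'(E, F)) : ℝ≥0∞ :=
  max (eCheminLernerNorm a (Ioo t₁ t₂) (criticalIndex E p + 2 * a.toReal⁻¹) p q U)
    (eCheminLernerNorm b (Ioo t₁ t₂) (criticalIndex E p + 2 * b.toReal⁻¹) p q U)

/-- Unfolding `eGKPPathNorm`. [cite: GKP2016, (1.5)] -/
theorem eGKPPathNorm_def (a b p q : ℝ≥0∞) [Fact (1 ≤ p)] (t₁ t₂ : ℝ) (U : ℝ → 𝓢'(E, F)) :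
    eGKPPathNorm a b p q t₁ t₂ U =
      max (eCheminLernerNorm a (Ioo t₁ t₂) (criticalIndex E p + 2 * a.toReal⁻¹) p q U)
        (eCheminLernerNorm b (Ioo t₁ t₂) (criticalIndex E p + 2 * b.toReal⁻¹) p q U) :=
  rfl

/-- The endpoint regularities of `𝓛^{1:∞}_{p,q}`: `s_p + 2/1 = s_p + 2` and `s_p + 2/∞ = s_p`
(GKP 2016, (1.5): `𝓛^{1:∞}_{p,q} = L̃¹(Ḃ^{s_p+2}_{p,q}) ∩ L̃^∞(Ḃ^{s_p}_{p,q})`). [cite: GKP2016, (1.5)] -/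
theorem eGKPPathNorm_one_top (p q : ℝ≥0∞) [Fact (1 ≤ p)] (t₁ t₂ : ℝ) (U : ℝ → 𝓢'(E, F)) :
    eGKPPathNorm 1 ∞ p q t₁ t₂ U =
      max (eCheminLernerNorm 1 (Ioo t₁ t₂) (criticalIndex E p + 2) p q U)
        (eCheminLernerNorm ∞ (Ioo t₁ t₂) (criticalIndex E p) p q U) := by
  simp [eGKPPathNorm]

/-- The path-space norm is monotone in the interval (GKP 2016, Rem. 1.3). [cite: GKP2016, Rem. 1.3] -/
theorem eGKPPathNorm_mono {a b p q : ℝ≥0∞} [Fact (1 ≤ p)] {t₁ t₂ t₁' t₂' : ℝ} (h₁ : t₁' ≤ t₁)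
    (h₂ : t₂ ≤ t₂') (U : ℝ → 𝓢'(E, F)) :
    eGKPPathNorm a b p q t₁ t₂ U ≤ eGKPPathNorm a b p q t₁' t₂' U :=
  max_le_max (eCheminLernerNorm_mono (Ioo_subset_Ioo h₁ h₂) _ _ _ _)
    (eCheminLernerNorm_mono (Ioo_subset_Ioo h₁ h₂) _ _ _ _)

/-- The path-space norm of the zero path vanishes. [folklore] -/
@[simp]
theorem eGKPPathNorm_zero (a b p q : ℝ≥0∞) [Fact (1 ≤ p)] (t₁ t₂ : ℝ) :
    eGKPPathNorm a b p q t₁ t₂ (0 : ℝ → 𝓢'(E, F)) = 0 := by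
  simp [eGKPPathNorm]

/-! ## Kato norms -/

/-- **Kato norm** of a distribution-valued path: `‖U‖ := sup_{0 < t ≤ T} t^α ‖U(t)‖_{L^p}`
(Gallagher–Koch–Planchon 2016, (4.1): the space `𝒦_q(T)` with `α = -s_q/2 = (1 - 3/q)/2 > 0`; Kato 1984).
A genuine supremum over the half-open interval; `[0, ∞]`-valued. [cite: GKP2016, (4.1)] -/
def eKatoNormDistrib (α T : ℝ) (p : ℝ≥0∞) [Fact (1 ≤ p)] (U : ℝ → 𝓢'(E, F)) : ℝ≥0∞ :=
  ⨆ t ∈ Ioc 0 T, ENNReal.ofReal (t ^ α) * eLpNormDistrib p (U t)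

/-- Unfolding the Kato norm. [cite: GKP2016, (4.1)] -/
theorem eKatoNormDistrib_def (α T : ℝ) (p : ℝ≥0∞) [Fact (1 ≤ p)] (U : ℝ → 𝓢'(E, F)) :
    eKatoNormDistrib α T p U = ⨆ t ∈ Ioc 0 T, ENNReal.ofReal (t ^ α) * eLpNormDistrib p (U t) :=
  rfl

/-- Each weighted slice is bounded by the Kato norm. [cite: GKP2016, (4.1)] -/
theorem mul_eLpNormDistrib_le_eKatoNormDistrib (α : ℝ) {T t : ℝ} (ht : t ∈ Ioc 0 T) (p : ℝ≥0∞)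
    [Fact (1 ≤ p)] (U : ℝ → 𝓢'(E, F)) :
    ENNReal.ofReal (t ^ α) * eLpNormDistrib p (U t) ≤ eKatoNormDistrib α T p U :=
  le_iSup₂ (f := fun τ (_ : τ ∈ Ioc 0 T) => ENNReal.ofReal (τ ^ α) * eLpNormDistrib p (U τ)) t ht

/-- The Kato norm is the least bound of the weighted slices: `‖U‖_{𝒦} ≤ B` iff
`t^α ‖U(t)‖_{L^p} ≤ B` for all `0 < t ≤ T`. [cite: GKP2016, (4.1)] -/
theorem eKatoNormDistrib_le_iff {α T : ℝ} {p : ℝ≥0∞} [Fact (1 ≤ p)] {U : ℝ → 𝓢'(E, F)} {B : ℝ≥0∞} :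
    eKatoNormDistrib α T p U ≤ B ↔ ∀ t ∈ Ioc 0 T, ENNReal.ofReal (t ^ α) * eLpNormDistrib p (U t) ≤ B :=
  iSup₂_le_iff

/-- The Kato norm is monotone in `T`. [cite: GKP2016, (4.1)] -/
theorem eKatoNormDistrib_mono (α : ℝ) {T T' : ℝ} (h : T ≤ T') (p : ℝ≥0∞) [Fact (1 ≤ p)]
    (U : ℝ → 𝓢'(E, F)) : eKatoNormDistrib α T p U ≤ eKatoNormDistrib α T' p U :=
  eKatoNormDistrib_le_iff.2 fun _ ht =>
    mul_eLpNormDistrib_le_eKatoNormDistrib α ⟨ht.1, ht.2.trans h⟩ p U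

/-- The Kato norm of the zero path vanishes. [folklore] -/
@[simp]
theorem eKatoNormDistrib_zero (α T : ℝ) (p : ℝ≥0∞) [Fact (1 ≤ p)] :
    eKatoNormDistrib α T p (0 : ℝ → 𝓢'(E, F)) = 0 := by
  simp [eKatoNormDistrib]

end Literature.Analysis.FunctionSpaces
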